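import Mathlib
import HarnessLib
import Literature.MathematicalPhysics.StatisticalMechanics.FluctuationKernelComparisonConnTorusFRD
import Literature.MathematicalPhysics.StatisticalMechanics.TuningLipschitzTorusFRD
import Literature.MathematicalPhysics.StatisticalMechanics.StepOperatorBLipschitz

/-!
# Hypothesis (12.52) of [ABKM19] Lemma 12.6 for `B_k`, torus data, with a VOLUME-UNIFORM constant:
# `‖B^{(q')}_k v − B^{(q)}_k v‖_{k+1,0} ≤ b_T · Σ|q'−q| · ‖v‖_k`, `b_T` independent of `N` (the q-slot F4b)

`TuningLipschitzTorusFRD.exists_norm_rgBQ_sub_le_of_torusFRD` proves (12.52) for the torus steps with a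
constant containing `gaussCompConst(|Λ|, q_H) ~ e^{3|Λ|/16}` (crude Gaussian comparison) and a local/far
split.  With the volume-uniform Lemma 8.4 (`ℓ = 1`) for connected polymers
(`FluctuationKernelComparisonConnTorusFRD.tayNormLE_fluct_sub_fluct_conn_of_torusFRD`) as the pair
property of `StepOperatorBLipschitz.hamNorm_opB_sub_abkm_le_of_stepKernelBounds` — after absorbing the
polynomial `(|X|_k + c₁)^{d/2}` into the large-set base, `κ' = 2^d κ` — the same bound holds with an
`N`-independent constant and without any smallness or far-field case:

* `two_mul_add_le_pow` — `2(m + c₁) ≤ 2(c₁ + 1)·2^m`;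
* **`hamNorm_opB_sub_unif_of_torusFRD`** — `‖B_{𝒞_{1+q'}}K − B_{𝒞_{1+q}}K‖_{k+1,0} ≤ L^d C_{8.7} C ℓ (2^dκ) A⁻¹`,
  `ℓ = (r₀+1)·8q_H·(3^{d+1}(2(c₁+1))^d)^{1/2}·T e^{2KT} K`, `c₁ = 2(2^d+R)+2p_Φ+1`, `T = Σ|q'−q|`;
* **`norm_rgBQ_sub_le_unif_of_torusFRD`** — (12.52) for `rgBQ` on the ball `Σ|q| ≤ T₀ ≤ ½`:
  `‖B^{(q')}_k v − B^{(q)}_k v‖ ≤ b_T · Σ|q'−q| · c_v` with the explicit `N`-free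
  `b_T = L^d C_{8.7} (r₀+1) 8q_H (3^{d+1}(2(c₁+1))^d)^{1/2} e^{2K} K (2^dκ) A⁻¹`.

Everything is proved; no named fact.  (Family (F4b) of the route's F4 statement; constants depend on
`L, d, R, p_Φ, r₀` and the package only.)

## References
* S. Adams, S. Buchholz, R. Kotecký, S. Müller, arXiv:1910.13564, Lemma 12.6 (12.52), Lemma 8.4
  [AdamsBuchholzKoteckyMuller2019].
* S. Buchholz, J. Funct. Anal. 275 (2018), Thm 4.5 [Buchholz2016].
-/

noncomputable section

namespace Literature.MathematicalPhysics.StatisticalMechanics.GradientRG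

open scoped BigOperators
open Real Set Finset MeasureTheory
open Literature.MathematicalPhysics.StatisticalMechanics.GradientFRD
  (fourierCoeff cExt cExt_of_mem IsElliptic IsUnitSymm InShell iterDiff supNorm conv ellOp isElliptic_one)
open Literature.MathematicalPhysics.StatisticalMechanics.TorusPolymer (IsPolymer numBlocks blockOf boxCorner)
open Literature.Barriers.CriticalPhenomena.LongRangePhi4.Polymer (IsConn)
open Literature.MathematicalPhysics.QuantumFieldTheory

variable {d M : ℕ} [NeZero M]

/-- `2(m + c₁) ≤ 2(c₁+1)·2^m`: the polynomial growth in the number of blocks is absorbed by an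
exponential. [cite: AdamsBuchholzKoteckyMuller2019, Ch. 8 (p. 65)] -/
theorem two_mul_add_le_pow (m c₁ : ℕ) : 2 * (m + c₁) ≤ 2 * (c₁ + 1) * 2 ^ m := by
  have h1 : m + 1 ≤ 2 ^ m := Nat.lt_two_pow_self
  have h2 : m + c₁ ≤ (c₁ + 1) * 2 ^ m := by
    calc m + c₁ ≤ (m + 1) + c₁ * 1 := by omega
      _ ≤ 2 ^ m + c₁ * 2 ^ m := add_le_add h1 (Nat.mul_le_mul_left _ (Nat.one_le_two_pow))
      _ = (c₁ + 1) * 2 ^ m := by ring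
  calc 2 * (m + c₁) ≤ 2 * ((c₁ + 1) * 2 ^ m) := Nat.mul_le_mul_left _ h2
    _ = 2 * (c₁ + 1) * 2 ^ m := by ring

/-- The square root of the polymer factor: `(3^{d+1}(2(m+c₁))^d)^{1/2} ≤ (3^{d+1}(2(c₁+1))^d)^{1/2}·(2^d)^m`.
[cite: AdamsBuchholzKoteckyMuller2019, Ch. 8 (p. 65)] -/
theorem sqrt_polymerFactor_le (d m c₁ : ℕ) :
    Real.sqrt ((3 : ℝ) ^ (d + 1) * (((2 * (m + c₁) : ℕ) : ℝ)) ^ d) ≤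
      Real.sqrt ((3 : ℝ) ^ (d + 1) * (((2 * (c₁ + 1) : ℕ) : ℝ)) ^ d) * ((2 : ℝ) ^ d) ^ m := by
  have hZ1 : (1 : ℝ) ≤ ((2 : ℝ) ^ d) ^ m := one_le_pow₀ (one_le_pow₀ (by norm_num))
  have hZ0 : (0 : ℝ) ≤ ((2 : ℝ) ^ d) ^ m := by positivity
  have hnat : ((2 * (m + c₁) : ℕ) : ℝ) ≤ ((2 * (c₁ + 1) : ℕ) : ℝ) * (2 : ℝ) ^ m := by
    have := two_mul_add_le_pow m c₁
    exact_mod_cast this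
  have hpow : (((2 * (m + c₁) : ℕ) : ℝ)) ^ d ≤ (((2 * (c₁ + 1) : ℕ) : ℝ)) ^ d * ((2 : ℝ) ^ d) ^ m := by
    calc (((2 * (m + c₁) : ℕ) : ℝ)) ^ d ≤ (((2 * (c₁ + 1) : ℕ) : ℝ) * (2 : ℝ) ^ m) ^ d :=
          pow_le_pow_left₀ (Nat.cast_nonneg _) hnat d
      _ = (((2 * (c₁ + 1) : ℕ) : ℝ)) ^ d * ((2 : ℝ) ^ d) ^ m := by rw [mul_pow, ← pow_mul, ← pow_mul, mul_comm d m]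
  calc Real.sqrt ((3 : ℝ) ^ (d + 1) * (((2 * (m + c₁) : ℕ) : ℝ)) ^ d)
      ≤ Real.sqrt ((3 : ℝ) ^ (d + 1) * (((2 * (c₁ + 1) : ℕ) : ℝ)) ^ d * (((2 : ℝ) ^ d) ^ m) ^ 2) := by
        refine Real.sqrt_le_sqrt ?_
        rw [mul_assoc]
        refine mul_le_mul_of_nonneg_left (hpow.trans ?_) (by positivity)
        refine mul_le_mul_of_nonneg_left ?_ (by positivity)
        nlinarith
    _ = Real.sqrt ((3 : ℝ) ^ (d + 1) * (((2 * (c₁ + 1) : ℕ) : ℝ)) ^ d) * ((2 : ℝ) ^ d) ^ m := by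
        rw [Real.sqrt_mul (by positivity), Real.sqrt_sq hZ0]

section Package

variable {L N Mord R n ñ : ℕ} {θbar lam μ δ₁ δ₀ A𝒫 : ℝ}
    {𝒞 : Matrix (Fin d) (Fin d) ℝ → ℕ → (Fin d → ZMod M) → ℝ} {Mc : ℕ → ℝ}
    {Cα : (Fin d → ℕ) → ℕ → ℝ} {c C : ℝ} {Cℓ : ℕ → ℝ}

set_option maxHeartbeats 3200000 in
/-- **`‖B_{𝒞_{1+q'}}K − B_{𝒞_{1+q}}K‖_{k+1,0} ≤ L^d · C_{8.7} · C ℓ (2^dκ) A⁻¹` with an `N`-FREE `ℓ`** (module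
docstring): `ℓ = (r₀+1)·8q_H·(3^{d+1}(2(c₁+1))^d)^{1/2}·(T e^{2KT} K)`, `c₁ = 2(2^d+R)+2p_Φ+1`, `T = Σ|q'−q|`,
`κ = A𝒫(ρ'')^{1/p}` — for a package with the regularity gap `d + 1 ≤ 2(ñ−n)`, `q, q'` symmetric in the ball
`Σ|q| ≤ T₀ ≤ ½` (`K T₀ ≤ log(1+ρ)`), Hölder conjugates with `p(1+ρ) ≤ 1+ρ''`, and a local `C^{r₀}` activity
`K` with `‖K‖_k^{(A)} ≤ C`. [cite: AdamsBuchholzKoteckyMuller2019, Lemma 12.6 (12.52)] -/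
theorem hamNorm_opB_sub_unif_of_torusFRD
    (hd : 3 ≤ d) (hMord : 1 ≤ Mord) (hMR : Mord ≤ R) (hLodd : Odd L) (hL : 2 ^ (d + 3) + 16 * R ≤ L)
    (hM : M = L ^ N)
    (hθbar : 0 < θbar) (hlam : 0 < lam) (hn : 2 * Mord ≤ n) (hn2 : 2 ≤ n) (hnñ : n ≤ ñ)
    (hgap : d + 1 ≤ 2 * (ñ - n))
    (hc : 0 < c) (hC1 : 0 ≤ Cℓ 1)
    (hallA : ∀ A : Matrix (Fin d) (Fin d) ℝ, IsElliptic (1 / 2 : ℝ) 2 A →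
        (∀ k, 1 ≤ k → k ≤ N + 1 →
          ∑ x : Fin d → ZMod M, 𝒞 A k x = 0 ∧ ∀ x, 𝒞 A k (-x) = 𝒞 A k x) ∧
        (∀ k, 1 ≤ k → k ≤ N + 1 → ∀ φ : (Fin d → ZMod M) → ℝ, ∑ x, φ x = 0 →
          0 ≤ ∑ x, ∑ y, φ x * 𝒞 A k (x - y) * φ y) ∧
        (∀ φ : (Fin d → ZMod M) → ℝ, ∑ x, φ x = 0 →
          ellOp A (conv (fun x => ∑ k ∈ Finset.Icc 1 (N + 1), 𝒞 A k x) φ) = φ) ∧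
        (∀ k, 1 ≤ k → k ≤ N → Mc k ≤ 0 ∧
          ∀ x : Fin d → ZMod M, ((L : ℝ) ^ k) / 2 ≤ (supNorm x : ℝ) →
            𝒞 A k x = Mc k) ∧
        (∀ k, 1 ≤ k → k ≤ N + 1 → ∀ B : Matrix (Fin d) (Fin d) ℝ, IsUnitSymm B →
          (∃ ε : ℝ, 0 < ε ∧ ∀ x : Fin d → ZMod M,
            ContDiffOn ℝ ⊤ (fun s : ℝ => 𝒞 (A + s • B) k x) (Set.Ioo (-ε) ε)) ∧
          ∀ α : Fin d → ℕ, ∑ i, α i ≤ n → ∀ ℓ : ℕ, ∀ x : Fin d → ZMod M,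
            abs (iteratedDeriv ℓ (fun s : ℝ => iterDiff α (𝒞 (A + s • B) k) x) 0)
              ≤ Cα α ℓ / (L : ℝ) ^ ((k - 1) * (d - 2 + ∑ i, α i))) ∧
        (∀ k, 1 ≤ k → k ≤ N + 1 → ∀ j : ℕ, ∀ κ : Fin d → ZMod M, κ ≠ 0 → InShell L j κ →
          (j < k →
            c / (L : ℝ) ^ (2 * (d + ñ) + 1) * (L : ℝ) ^ (2 * j)
                / (L : ℝ) ^ ((k - j) * (d - 1 + n)) ≤ (fourierCoeff (𝒞 A k) κ).re ∧
            ‖fourierCoeff (𝒞 A k) κ‖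
              ≤ C * (L : ℝ) ^ (2 * (d + ñ) + 1) * (L : ℝ) ^ (2 * j)
                  / (L : ℝ) ^ ((k - j) * (d - 1 + n))) ∧
          (k ≤ j →
            c / (L : ℝ) ^ (2 * (d + ñ) + 1) * (L : ℝ) ^ (2 * k)
                ≤ (fourierCoeff (𝒞 A k) κ).re ∧
            ‖fourierCoeff (𝒞 A k) κ‖ ≤ C * (L : ℝ) ^ (2 * k)) ∧
          ∀ B : Matrix (Fin d) (Fin d) ℝ, IsUnitSymm B → ∀ ℓ : ℕ, 1 ≤ ℓ →
            (j < k →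
              ‖iteratedDeriv ℓ (fun s : ℝ => fourierCoeff (𝒞 (A + s • B) k) κ) 0‖
                ≤ Cℓ ℓ * (L : ℝ) ^ (2 * (d + ñ) + 1) * (L : ℝ) ^ (2 * j)
                    / (L : ℝ) ^ ((k - j) * (d - 1 + ñ))) ∧
            (k ≤ j →
              ‖iteratedDeriv ℓ (fun s : ℝ => fourierCoeff (𝒞 (A + s • B) k) κ) 0‖
                ≤ Cℓ ℓ * (L : ℝ) ^ (2 * k))))
    (hB : AbkmWeightBounds L N Mord R n θbar lam μ δ₁ δ₀ A𝒫 (fun j => 𝒞 1 j)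
      (abkmWeightData L N Mord R θbar (schedDelta δ₀ δ₁ N) fun j => 𝒞 1 j))
    {k : ℕ} (hkN : k + 1 ≤ N) {pT r₀ : ℕ} (hpM : pT + d ≤ Mord) (hr₀ : 3 ≤ r₀) {h A : ℝ} (hh : 0 < h)
    (hA : 1 ≤ A) {ρ : ℝ} (hρ0 : 0 ≤ ρ) (hρ : ρ < θbar)
    {T₀ : ℝ} (hT₀ : T₀ ≤ 1 / 2) (hKT₀ : shellRatioConst c (Cℓ 1) (L : ℝ) d ñ * T₀ ≤ Real.log (1 + ρ))
    {q q' : Matrix (Fin d) (Fin d) ℝ} (hq : q.IsSymm) (hq' : q'.IsSymm)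
    (hqT : ∑ i, ∑ j, |q i j| ≤ T₀) (hq'T : ∑ i, ∑ j, |q' i j| ≤ T₀)
    {p qH ρ'' : ℝ} (hpq : p.HolderConjugate qH) (hρ''0 : 0 ≤ ρ'') (hρ'' : ρ'' < θbar)
    (hpρ : p * (1 + ρ) ≤ 1 + ρ'')
    {K : Finset (Fin d → ZMod M) → ((Fin d → ZMod M) → ℝ) → ℂ} {C : ℝ} (hC : 0 ≤ C)
    (hK : WeakNormLE (abkmNormParams L N Mord R pT r₀ h θbar A (schedDelta δ₀ δ₁ N) fun j => 𝒞 1 j) k K C)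
    (hKd : ∀ X, ContDiff ℝ r₀ (K X))
    (hKloc : ∀ X, IsPolymer (L ^ k) X → IsConn X →
      IsGaugeLocal ((abkmNormParams L N Mord R pT r₀ h θbar A (schedDelta δ₀ δ₁ N) fun j => 𝒞 1 j).gauge k X)
        (K X)) :
    hamNorm (fieldWt h L d (k + 1)) ((L : ℝ) ^ (k + 1)) (L ^ (d * (k + 1)))
        (opB (abkmStepData L R k fun j => 𝒞 ((1 : Matrix (Fin d) (Fin d) ℝ) + q') j) K -
          opB (abkmStepData L R k fun j => 𝒞 ((1 : Matrix (Fin d) (Fin d) ℝ) + q) j) K) ≤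
      (L : ℝ) ^ d * (pi2BoundConst d (((2 * R + 2 : ℕ) : ℝ) + ((d / 2 + 1 : ℕ) : ℝ)) *
        (C * ((r₀ + 1) * (8 * qH *
            (Real.sqrt ((3 : ℝ) ^ (d + 1) * (((2 * ((2 * (2 ^ d + R) + 2 * pT + 1) + 1) : ℕ) : ℝ)) ^ d) *
              ((∑ i, ∑ j, |(q' - q) i j|) *
                Real.exp (2 * shellRatioConst c (Cℓ 1) (L : ℝ) d ñ * ∑ i, ∑ j, |(q' - q) i j|) *
                shellRatioConst c (Cℓ 1) (L : ℝ) d ñ)))) *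
          ((2 : ℝ) ^ d * weightIntConstRho θbar ρ'' (traceConst d Mord R lam (derivSum d n fun θ' _ => Cα θ' 0)) ^ (1 / p)) *
            A⁻¹)) := by
  set Da := abkmStepData L R k fun j => 𝒞 ((1 : Matrix (Fin d) (Fin d) ℝ) + q') j with hDa
  set Db := abkmStepData L R k fun j => 𝒞 ((1 : Matrix (Fin d) (Fin d) ℝ) + q) j with hDb
  have hk : k + 1 ≤ N + 1 := by omega
  have hSa : StepKernelBounds (abkmWeightData L N Mord R θbar (schedDelta δ₀ δ₁ N) fun j => 𝒞 1 j) L k _ _ Da.𝒞 :=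
    stepKernelBounds_one_add_of_torusFRD hd hMord hMR hLodd hL hθbar hlam hn hn2 hnñ hc hC1 hallA hB hk
      hρ0 hρ hT₀ hKT₀ hq' hq'T
  have hSb : StepKernelBounds (abkmWeightData L N Mord R θbar (schedDelta δ₀ δ₁ N) fun j => 𝒞 1 j) L k _ _ Db.𝒞 :=
    stepKernelBounds_one_add_of_torusFRD hd hMord hMR hLodd hL hθbar hlam hn hn2 hnñ hc hC1 hallA hB hk
      hρ0 hρ hT₀ hKT₀ hq hqT
  have hA𝒫p : 0 ≤ weightIntConstRho θbar ρ'' (traceConst d Mord R lam (derivSum d n fun θ' _ => Cα θ' 0)) :=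
    zero_le_one.trans (one_le_weightIntConstRho hθbar hρ''0 hρ''
      (traceConst_nonneg d Mord R hlam.le (derivSum_nonneg d n _)))
  set κ := weightIntConstRho θbar ρ'' (traceConst d Mord R lam (derivSum d n fun θ' _ => Cα θ' 0)) ^ (1 / p) with hκdef
  have hκ0 : 0 ≤ κ := Real.rpow_nonneg hA𝒫p _
  set c₁ : ℕ := 2 * (2 ^ d + R) + 2 * pT + 1 with hc₁
  set EK := (∑ i, ∑ j, |(q' - q) i j|) *
      Real.exp (2 * shellRatioConst c (Cℓ 1) (L : ℝ) d ñ * ∑ i, ∑ j, |(q' - q) i j|) *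
      shellRatioConst c (Cℓ 1) (L : ℝ) d ñ with hEK
  have hK0' : 0 ≤ shellRatioConst c (Cℓ 1) (L : ℝ) d ñ := shellRatioConst_nonneg hc hC1 (Nat.cast_nonneg _) d ñ
  have hT0 : 0 ≤ ∑ i, ∑ j, |(q' - q) i j| := sum_nonneg fun _ _ => sum_nonneg fun _ _ => abs_nonneg _
  have hEK0 : 0 ≤ EK := by positivity
  -- the pair property on connected polymers, polynomial factor absorbed into `κ' = 2^d κ`
  refine hamNorm_opB_sub_abkm_le_of_stepKernelBounds hd hLodd hL hM hkN hpM hMR hr₀ hB hh hA Da Db hSa hSb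
    (x₀ := 0) rfl rfl rfl rfl
    (ℓ := (r₀ + 1) * (8 * qH * (Real.sqrt ((3 : ℝ) ^ (d + 1) * (((2 * (c₁ + 1) : ℕ) : ℝ)) ^ d) * EK)))
    (κ := (2 : ℝ) ^ d * κ) (fun X hX hXc F C0 hC0 hFd hFloc hF => ?_) hC hK hKd hKloc
  have hconn := tayNormLE_fluct_sub_fluct_conn_of_torusFRD hd hMord hMR hLodd hL hM hθbar hlam hn hn2 hnñ hgap hc hC1
    hallA hB hkN hρ0 hρ hT₀ hKT₀ hq hq' hqT hq'T hpq hρ''0 hρ'' hpρ hX hXc hC0 hFd hFloc hF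
    (pT := pT) (r₀ := r₀) (h := h) (A := A)
  refine hconn.mono ?_ (fun φ => ((abkmWeightData L N Mord R θbar (schedDelta δ₀ δ₁ N) fun j => 𝒞 1 j).midWeight_pos k X φ).le)
  set m := numBlocks (L ^ k) X with hm
  have hsq := sqrt_polymerFactor_le d m c₁
  have hmc : 2 * (m + 2 * (2 ^ d + R) + 2 * pT + 1) = 2 * (m + c₁) := by rw [hc₁]; ring
  rw [hmc]
  have hq1 : 0 ≤ qH := by linarith [hpq.symm.lt]
  calc C0 * ((r₀ + 1) * (8 * qH * (Real.sqrt ((3 : ℝ) ^ (d + 1) * (((2 * (m + c₁) : ℕ) : ℝ)) ^ d) * EK))) * κ ^ m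
      ≤ C0 * ((r₀ + 1) * (8 * qH *
          (Real.sqrt ((3 : ℝ) ^ (d + 1) * (((2 * (c₁ + 1) : ℕ) : ℝ)) ^ d) * ((2 : ℝ) ^ d) ^ m * EK))) * κ ^ m := by
        have : Real.sqrt ((3 : ℝ) ^ (d + 1) * (((2 * (m + c₁) : ℕ) : ℝ)) ^ d) * EK ≤
            Real.sqrt ((3 : ℝ) ^ (d + 1) * (((2 * (c₁ + 1) : ℕ) : ℝ)) ^ d) * ((2 : ℝ) ^ d) ^ m * EK :=
          mul_le_mul_of_nonneg_right hsq hEK0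
        gcongr
    _ = C0 * ((r₀ + 1) * (8 * qH * (Real.sqrt ((3 : ℝ) ^ (d + 1) * (((2 * (c₁ + 1) : ℕ) : ℝ)) ^ d) * EK))) *
          ((2 : ℝ) ^ d * κ) ^ m := by
        rw [mul_pow]; ring

/-- **(12.52) with a volume-uniform constant for `rgBQ`** (the q-slot F4b): for `q, q'` symmetric in the
ball `Σ|q| ≤ T₀ ≤ ½` and `k + 1 ≤ N`, `‖B^{(q')}_k v − B^{(q)}_k v‖ ≤ b_T · Σ|q'−q| · c_v` with the explicit
`N`-free `b_T = L^d C_{8.7} (r₀+1) 8q_H (3^{d+1}(2(c₁+1))^d)^{1/2} e^{2K} K (2^dκ) A⁻¹` (`Σ|q'−q| ≤ 1`, so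
`e^{2KΣ|q'−q|} ≤ e^{2K}`). [cite: AdamsBuchholzKoteckyMuller2019, Lemma 12.6 (12.52)] -/
theorem norm_rgBQ_sub_le_unif_of_torusFRD {h : ℝ} [Fact (0 < h)] [Fact (0 < L)]
    (hd : 3 ≤ d) (hMord : 1 ≤ Mord) (hMR : Mord ≤ R) (hLodd : Odd L) (hL : 2 ^ (d + 3) + 16 * R ≤ L)
    (hM : M = L ^ N)
    (hθbar : 0 < θbar) (hlam : 0 < lam) (hn : 2 * Mord ≤ n) (hn2 : 2 ≤ n) (hnñ : n ≤ ñ)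
    (hgap : d + 1 ≤ 2 * (ñ - n))
    (hc : 0 < c) (hC1 : 0 ≤ Cℓ 1)
    (hallA : ∀ A : Matrix (Fin d) (Fin d) ℝ, IsElliptic (1 / 2 : ℝ) 2 A →
        (∀ k, 1 ≤ k → k ≤ N + 1 →
          ∑ x : Fin d → ZMod M, 𝒞 A k x = 0 ∧ ∀ x, 𝒞 A k (-x) = 𝒞 A k x) ∧
        (∀ k, 1 ≤ k → k ≤ N + 1 → ∀ φ : (Fin d → ZMod M) → ℝ, ∑ x, φ x = 0 →
          0 ≤ ∑ x, ∑ y, φ x * 𝒞 A k (x - y) * φ y) ∧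
        (∀ φ : (Fin d → ZMod M) → ℝ, ∑ x, φ x = 0 →
          ellOp A (conv (fun x => ∑ k ∈ Finset.Icc 1 (N + 1), 𝒞 A k x) φ) = φ) ∧
        (∀ k, 1 ≤ k → k ≤ N → Mc k ≤ 0 ∧
          ∀ x : Fin d → ZMod M, ((L : ℝ) ^ k) / 2 ≤ (supNorm x : ℝ) →
            𝒞 A k x = Mc k) ∧
        (∀ k, 1 ≤ k → k ≤ N + 1 → ∀ B : Matrix (Fin d) (Fin d) ℝ, IsUnitSymm B →
          (∃ ε : ℝ, 0 < ε ∧ ∀ x : Fin d → ZMod M,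
            ContDiffOn ℝ ⊤ (fun s : ℝ => 𝒞 (A + s • B) k x) (Set.Ioo (-ε) ε)) ∧
          ∀ α : Fin d → ℕ, ∑ i, α i ≤ n → ∀ ℓ : ℕ, ∀ x : Fin d → ZMod M,
            abs (iteratedDeriv ℓ (fun s : ℝ => iterDiff α (𝒞 (A + s • B) k) x) 0)
              ≤ Cα α ℓ / (L : ℝ) ^ ((k - 1) * (d - 2 + ∑ i, α i))) ∧
        (∀ k, 1 ≤ k → k ≤ N + 1 → ∀ j : ℕ, ∀ κ : Fin d → ZMod M, κ ≠ 0 → InShell L j κ →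
          (j < k →
            c / (L : ℝ) ^ (2 * (d + ñ) + 1) * (L : ℝ) ^ (2 * j)
                / (L : ℝ) ^ ((k - j) * (d - 1 + n)) ≤ (fourierCoeff (𝒞 A k) κ).re ∧
            ‖fourierCoeff (𝒞 A k) κ‖
              ≤ C * (L : ℝ) ^ (2 * (d + ñ) + 1) * (L : ℝ) ^ (2 * j)
                  / (L : ℝ) ^ ((k - j) * (d - 1 + n))) ∧
          (k ≤ j →
            c / (L : ℝ) ^ (2 * (d + ñ) + 1) * (L : ℝ) ^ (2 * k)
                ≤ (fourierCoeff (𝒞 A k) κ).re ∧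
            ‖fourierCoeff (𝒞 A k) κ‖ ≤ C * (L : ℝ) ^ (2 * k)) ∧
          ∀ B : Matrix (Fin d) (Fin d) ℝ, IsUnitSymm B → ∀ ℓ : ℕ, 1 ≤ ℓ →
            (j < k →
              ‖iteratedDeriv ℓ (fun s : ℝ => fourierCoeff (𝒞 (A + s • B) k) κ) 0‖
                ≤ Cℓ ℓ * (L : ℝ) ^ (2 * (d + ñ) + 1) * (L : ℝ) ^ (2 * j)
                    / (L : ℝ) ^ ((k - j) * (d - 1 + ñ))) ∧
            (k ≤ j →
              ‖iteratedDeriv ℓ (fun s : ℝ => fourierCoeff (𝒞 (A + s • B) k) κ) 0‖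
                ≤ Cℓ ℓ * (L : ℝ) ^ (2 * k))))
    (hB : AbkmWeightBounds L N Mord R n θbar lam μ δ₁ δ₀ A𝒫 (fun j => 𝒞 1 j)
      (abkmWeightData L N Mord R θbar (schedDelta δ₀ δ₁ N) fun j => 𝒞 1 j))
    {pT r₀ : ℕ} (hpM : pT + d ≤ Mord) (hr₀ : 3 ≤ r₀) {A : ℝ} (hA : 1 ≤ A)
    {ρ : ℝ} (hρ0 : 0 ≤ ρ) (hρ : ρ < θbar)
    {T₀ : ℝ} (hT₀ : T₀ ≤ 1 / 2) (hKT₀ : shellRatioConst c (Cℓ 1) (L : ℝ) d ñ * T₀ ≤ Real.log (1 + ρ))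
    {p qH ρ'' : ℝ} (hpq : p.HolderConjugate qH) (hρ''0 : 0 ≤ ρ'') (hρ'' : ρ'' < θbar)
    (hpρ : p * (1 + ρ) ≤ 1 + ρ'')
    {q q' : Matrix (Fin d) (Fin d) ℝ} (hq : q.IsSymm) (hq' : q'.IsSymm)
    (hqT : ∑ i, ∑ j, |q i j| ≤ T₀) (hq'T : ∑ i, ∑ j, |q' i j| ≤ T₀)
    {k : ℕ} (hk : k + 1 ≤ N)
    (v : activitySpace (abkmNormParams L N Mord R pT r₀ h θbar A (schedDelta δ₀ δ₁ N) fun j => 𝒞 1 j) k)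
    {cv : ℝ}
    (hv : activityNormLE (abkmNormParams L N Mord R pT r₀ h θbar A (schedDelta δ₀ δ₁ N) fun j => 𝒞 1 j) k v cv) :
    ‖rgBQ (p := pT) (A := A) hB (by omega) hLodd hM
          (stepKernelBounds_family_of_torusFRD hd hMord hMR hLodd hL hθbar hlam hn hn2 hnñ hc hC1 hallA hB
            hρ0 hρ hT₀ hKT₀ hq' hq'T) k v -
        rgBQ (p := pT) (A := A) hB (by omega) hLodd hM
          (stepKernelBounds_family_of_torusFRD hd hMord hMR hLodd hL hθbar hlam hn hn2 hnñ hc hC1 hallA hB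
            hρ0 hρ hT₀ hKT₀ hq hqT) k v‖ ≤
      ((L : ℝ) ^ d * (pi2BoundConst d (((2 * R + 2 : ℕ) : ℝ) + ((d / 2 + 1 : ℕ) : ℝ)) *
        ((r₀ + 1) * (8 * qH *
            (Real.sqrt ((3 : ℝ) ^ (d + 1) * (((2 * ((2 * (2 ^ d + R) + 2 * pT + 1) + 1) : ℕ) : ℝ)) ^ d) *
              (Real.exp (2 * shellRatioConst c (Cℓ 1) (L : ℝ) d ñ) * shellRatioConst c (Cℓ 1) (L : ℝ) d ñ))) *
          ((2 : ℝ) ^ d * weightIntConstRho θbar ρ'' (traceConst d Mord R lam (derivSum d n fun θ' _ => Cα θ' 0)) ^ (1 / p)) *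
            A⁻¹))) *
        (∑ i, ∑ j, |(q' - q) i j|) * cv := by
  have hh : 0 < h := Fact.out
  have hA0 : 0 < A := by linarith
  have hPA : 0 < (abkmNormParams L N Mord R pT r₀ h θbar A (schedDelta δ₀ δ₁ N) fun j => 𝒞 1 j).A := hA0
  -- data of `v`
  have hvW : WeakNormLE (abkmNormParams L N Mord R pT r₀ h θbar A (schedDelta δ₀ δ₁ N) fun j => 𝒞 1 j) k
      (v : Finset (Fin d → ZMod M) → ((Fin d → ZMod M) → ℝ) → ℂ) cv := hv
  have hvd : ∀ X, ContDiff ℝ r₀ ((v : Finset (Fin d → ZMod M) → ((Fin d → ZMod M) → ℝ) → ℂ) X) :=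
    activitySpace.contDiff v
  have hvloc : ∀ X, IsPolymer (L ^ k) X → IsConn X →
      IsGaugeLocal ((abkmNormParams L N Mord R pT r₀ h θbar A (schedDelta δ₀ δ₁ N) fun j => 𝒞 1 j).gauge k X)
        ((v : Finset (Fin d → ZMod M) → ((Fin d → ZMod M) → ℝ) → ℂ) X) :=
    fun X hX hXc => activitySpace.isGaugeLocal v hX hXc
  have hMt : M = (abkmNormParams L N Mord R pT r₀ h θbar A (schedDelta δ₀ δ₁ N) fun j => 𝒞 1 j).L ^ k * L ^ (N - k) := by
    show M = L ^ k * L ^ (N - k)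
    rw [hM, ← pow_add, Nat.add_sub_cancel' (by omega)]
  have hcv : 0 ≤ cv := nonneg_of_weakNormLE hPA hMt hLodd.pow hLodd.pow hvW
  -- rewrite the two `B`'s as `opB`
  set Da := abkmStepData L R k fun j => 𝒞 ((1 : Matrix (Fin d) (Fin d) ℝ) + q') j with hDa
  set Db := abkmStepData L R k fun j => 𝒞 ((1 : Matrix (Fin d) (Fin d) ℝ) + q) j with hDb
  have hSa := stepKernelBounds_family_of_torusFRD hd hMord hMR hLodd hL hθbar hlam hn hn2 hnñ hc hC1 hallA hB
    hρ0 hρ hT₀ hKT₀ hq' hq'T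
  have hSb := stepKernelBounds_family_of_torusFRD hd hMord hMR hLodd hL hθbar hlam hn hn2 hnñ hc hC1 hallA hB
    hρ0 hρ hT₀ hKT₀ hq hqT
  have hnorm : ‖rgBQ (p := pT) (A := A) hB (by omega) hLodd hM hSa k v -
        rgBQ (p := pT) (A := A) hB (by omega) hLodd hM hSb k v‖ =
      hamNorm (fieldWt h (L : ℝ) d (k + 1)) ((L : ℝ) ^ (k + 1)) (L ^ (d * (k + 1)))
        (opB Da (v : Finset (Fin d → ZMod M) → ((Fin d → ZMod M) → ℝ) → ℂ) -
          opB Db (v : Finset (Fin d → ZMod M) → ((Fin d → ZMod M) → ℝ) → ℂ)) := by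
    rw [HamSpace.norm_def, map_sub]
    unfold rgBQ
    rw [dif_pos hk, dif_pos hk]
    show hamNorm _ _ _ (HamSpace.toHam (HamSpace.ofHam (opBHomQ (p := pT) (A := A) hB (by omega) hLodd hM
        (abkmStepData L R k fun j => 𝒞 ((1 : Matrix (Fin d) (Fin d) ℝ) + q') j) (hSa k hk) (x₀ := 0) rfl v)) -
      HamSpace.toHam (HamSpace.ofHam (opBHomQ (p := pT) (A := A) hB (by omega) hLodd hM
        (abkmStepData L R k fun j => 𝒞 ((1 : Matrix (Fin d) (Fin d) ℝ) + q) j) (hSb k hk) (x₀ := 0) rfl v))) = _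
    rw [HamSpace.toHam_ofHam, HamSpace.toHam_ofHam, opBHomQ_apply, opBHomQ_apply]
  rw [hnorm]
  have hmain := hamNorm_opB_sub_unif_of_torusFRD hd hMord hMR hLodd hL hM hθbar hlam hn hn2 hnñ hgap hc hC1 hallA hB
    hk hpM hr₀ hh hA hρ0 hρ hT₀ hKT₀ hq hq' hqT hq'T hpq hρ''0 hρ'' hpρ hcv hvW hvd hvloc
  refine hmain.trans ?_
  -- `T = Σ|q'−q| ≤ 1`, so `e^{2KT} ≤ e^{2K}`
  set T := ∑ i, ∑ j, |(q' - q) i j| with hTdef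
  have hT0 : 0 ≤ T := sum_nonneg fun _ _ => sum_nonneg fun _ _ => abs_nonneg _
  have hT1 : T ≤ 1 := by
    have h1 : T ≤ ∑ i, ∑ j, (|q' i j| + |q i j|) := by
      refine sum_le_sum fun i _ => sum_le_sum fun j _ => ?_
      rw [Matrix.sub_apply]; exact abs_sub _ _
    have h2 : ∑ i, ∑ j, (|q' i j| + |q i j|) = (∑ i, ∑ j, |q' i j|) + ∑ i, ∑ j, |q i j| := by
      rw [← sum_add_distrib]; exact sum_congr rfl fun i _ => sum_add_distrib
    linarith [hqT, hq'T]
  set K := shellRatioConst c (Cℓ 1) (L : ℝ) d ñ with hKdef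
  have hK0 : 0 ≤ K := shellRatioConst_nonneg hc hC1 (Nat.cast_nonneg _) d ñ
  have hexp : Real.exp (2 * K * T) ≤ Real.exp (2 * K) := by
    refine Real.exp_le_exp.2 ?_
    calc 2 * K * T ≤ 2 * K * 1 := mul_le_mul_of_nonneg_left hT1 (by positivity)
      _ = 2 * K := mul_one _
  have hA𝒫p : 0 ≤ weightIntConstRho θbar ρ'' (traceConst d Mord R lam (derivSum d n fun θ' _ => Cα θ' 0)) :=
    zero_le_one.trans (one_le_weightIntConstRho hθbar hρ''0 hρ''
      (traceConst_nonneg d Mord R hlam.le (derivSum_nonneg d n _)))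
  have hκ0 : 0 ≤ (2 : ℝ) ^ d * weightIntConstRho θbar ρ'' (traceConst d Mord R lam (derivSum d n fun θ' _ => Cα θ' 0)) ^ (1 / p) :=
    mul_nonneg (by positivity) (Real.rpow_nonneg hA𝒫p _)
  have hC87 : 0 ≤ pi2BoundConst d (((2 * R + 2 : ℕ) : ℝ) + ((d / 2 + 1 : ℕ) : ℝ)) := pi2BoundConst_nonneg d (by positivity)
  have hq1 : 0 ≤ qH := by linarith [hpq.symm.lt]
  set S := Real.sqrt ((3 : ℝ) ^ (d + 1) * (((2 * ((2 * (2 ^ d + R) + 2 * pT + 1) + 1) : ℕ) : ℝ)) ^ d) with hS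
  have hS0 : 0 ≤ S := Real.sqrt_nonneg _
  have hstep : T * Real.exp (2 * K * T) * K ≤ Real.exp (2 * K) * K * T := by
    calc T * Real.exp (2 * K * T) * K ≤ T * Real.exp (2 * K) * K := by gcongr
      _ = Real.exp (2 * K) * K * T := by ring
  calc (L : ℝ) ^ d * (pi2BoundConst d (((2 * R + 2 : ℕ) : ℝ) + ((d / 2 + 1 : ℕ) : ℝ)) *
        (cv * ((r₀ + 1) * (8 * qH * (S * (T * Real.exp (2 * K * T) * K)))) *
          ((2 : ℝ) ^ d * weightIntConstRho θbar ρ'' (traceConst d Mord R lam (derivSum d n fun θ' _ => Cα θ' 0)) ^ (1 / p)) *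
            A⁻¹))
      ≤ (L : ℝ) ^ d * (pi2BoundConst d (((2 * R + 2 : ℕ) : ℝ) + ((d / 2 + 1 : ℕ) : ℝ)) *
        (cv * ((r₀ + 1) * (8 * qH * (S * (Real.exp (2 * K) * K * T)))) *
          ((2 : ℝ) ^ d * weightIntConstRho θbar ρ'' (traceConst d Mord R lam (derivSum d n fun θ' _ => Cα θ' 0)) ^ (1 / p)) *
            A⁻¹)) := by
        gcongr
    _ = ((L : ℝ) ^ d * (pi2BoundConst d (((2 * R + 2 : ℕ) : ℝ) + ((d / 2 + 1 : ℕ) : ℝ)) *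
        ((r₀ + 1) * (8 * qH * (S * (Real.exp (2 * K) * K))) *
          ((2 : ℝ) ^ d * weightIntConstRho θbar ρ'' (traceConst d Mord R lam (derivSum d n fun θ' _ => Cα θ' 0)) ^ (1 / p)) *
            A⁻¹))) * T * cv := by ring

end Package

end Literature.MathematicalPhysics.StatisticalMechanics.GradientRG

end
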